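import Summits.ValiantsHypothesis.ValiantsHypothesis.Theorems.LacunarySymmetroidMatrixDescartesDoorA26WallBubblingBubblingTwistedRolle

/-!
# Wall bubbling for `DoorA26` — (W) chain piece: MULTIPLICITY TRANSFER (Rolle–Hurwitz on a window)

HONEST FRAMING.  Chain lemma for obligation (W) `stub_weylFaces` of `Cruxes/DoorA26/Lines/wall_bubbling.lean` (stmt-ValiantsHypothesis-19979
`DoorA26`; OPEN, typed, never asserted), re-pointed seat val-sym-door-p1 g13 (W2 #5).  The line lead's rev-2 statement file
`Cruxes/DoorA26/Lines/wall_bubbling_ConfluentDoor.lean` types the CONFLUENT DOOR in MULTIPLICITY currency (zeros `z ∈ Z` with `iteratedDeriv j F z = 0`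
for `j < m z`, `Σ m z ≤ 19`).  The chain's robust counts are Rolle-type and consume slot structure, never the limit's zero count; a DOOR enters the
reduction «ConfluentDoor26 ⇒ Stmt.weylFaces_generic» only through a transfer of the approximants' zeros to the limit WITH MULTIPLICITY.  This file is
that transfer, in elementary real-variable form (no complex analysis):

* `rolle_count_iter` — iterating the chain's `rolle_count` along a derivative tower: `Z.card` zeros of `fd 0` in `[a,b]` ⇒ `≥ Z.card − j` zeros of
  `fd j` in `[a,b]`;
* `multiplicity_transfer` — derivative towers `fd ν` converging CONTINUOUSLY on `[A,B]` up to order `N − 1` to a tower `Fd` (i.e. `fd (φ k) j (t_k) →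
  Fd j t₀` whenever `t_k → t₀` in `[A,B]` along any subsequence — implied by uniform convergence of each derivative plus continuity of the limit), each
  `fd ν 0` with `N` distinct zeros in `[A,B]` ⇒ finitely many points of `[A,B]` at which `Fd j` vanishes for all `j < m z`, with `Σ m z ≥ N`.
  Mechanism: one compactness extraction of the sorted zero vectors `z^ν ∈ [A,B]^N` (`z^{φ k} → ζ`, `ζ` monotone); on each fibre `{i : ζ i = z}`
  (first index `i₀`, last `i₁`) Rolle `j` times inside the moving window `[z^{φ k} i₀, z^{φ k} i₁] → {z}`, squeeze, continuous convergence.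

No new definitions; nothing here bears on `DoorA26`, `MatrixDescartes` (stmt-ValiantsHypothesis-18050) or `VP ≠ VNP`.

[folklore] Rolle's theorem; Bolzano–Weierstrass; Hurwitz's theorem in its real-variable Rolle form.
-/

-- `Summit.ValiantsHypothesis.ValiantsHypothesis.…` repeats a component by the D-0017 layout
-- (single-conjunct summit), which the `dupNamespace` linter flags; the name is mandated.
set_option linter.dupNamespace false

namespace Summit.ValiantsHypothesis.ValiantsHypothesis.Theorems.LacunarySymmetroidMatrixDescartes.WallBubbling

open Finset Filter Topology
open scoped BigOperators

/-- Iterated Rolle along a derivative tower: `Z.card` zeros of `fd 0` in `[a,b]` give `≥ Z.card − j` zeros of `fd j` in `[a,b]`. [folklore] -/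
theorem rolle_count_iter (fd : ℕ → ℝ → ℝ) (hder : ∀ j t, HasDerivAt (fd j) (fd (j + 1) t) t) (a b : ℝ) :
    ∀ (j : ℕ) (Z : Finset ℝ), (∀ z ∈ Z, z ∈ Set.Icc a b ∧ fd 0 z = 0) →
      ∃ Z' : Finset ℝ, Z.card ≤ Z'.card + j ∧ ∀ z ∈ Z', z ∈ Set.Icc a b ∧ fd j z = 0 := by
  intro j
  induction j with
  | zero => intro Z hZ; exact ⟨Z, by simp, hZ⟩
  | succ j ih =>
    intro Z hZ
    obtain ⟨Z₁, hc₁, hZ₁⟩ := ih Z hZ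
    obtain ⟨Z₂, hc₂, hZ₂⟩ := Bubbling.rolle_count (hder j) a b Z₁ hZ₁
    exact ⟨Z₂, by omega, hZ₂⟩

/-- **MULTIPLICITY TRANSFER** (Rolle–Hurwitz on a window).  See the module docstring. [folklore] -/
theorem multiplicity_transfer {N : ℕ} (A B : ℝ) (fd : ℕ → ℕ → ℝ → ℝ) (Fd : ℕ → ℝ → ℝ)
    (hder : ∀ ν j t, HasDerivAt (fd ν j) (fd ν (j + 1) t) t)
    (hconv : ∀ j < N, ∀ φ : ℕ → ℕ, StrictMono φ → ∀ (t : ℕ → ℝ) (t₀ : ℝ), (∀ k, t k ∈ Set.Icc A B) →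
      Tendsto t atTop (𝓝 t₀) → Tendsto (fun k => fd (φ k) j (t k)) atTop (𝓝 (Fd j t₀)))
    (hz : ∀ ν, ∃ z : Fin N → ℝ, StrictMono z ∧ ∀ i, z i ∈ Set.Icc A B ∧ fd ν 0 (z i) = 0) :
    ∃ (Z : Finset ℝ) (m : ℝ → ℕ), (∀ z ∈ Z, z ∈ Set.Icc A B ∧ ∀ j < m z, Fd j z = 0) ∧ N ≤ ∑ z ∈ Z, m z := by
  classical
  choose z hzmono hz0 using hz
  -- one compactness extraction in `[A,B]^N`
  have hmem : ∀ ν, z ν ∈ Set.Icc (fun _ : Fin N => A) (fun _ => B) := fun ν =>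
    ⟨fun i => (hz0 ν i).1.1, fun i => (hz0 ν i).1.2⟩
  obtain ⟨ζ, hζmem, φ, hφ, hlim⟩ := (isCompact_Icc (a := fun _ : Fin N => A) (b := fun _ => B)).tendsto_subseq hmem
  have hlim_i : ∀ i, Tendsto (fun k => z (φ k) i) atTop (𝓝 (ζ i)) := fun i => tendsto_pi_nhds.mp hlim i
  have hζmono : Monotone ζ := by
    intro i i' hii'
    exact le_of_tendsto_of_tendsto' (hlim_i i) (hlim_i i') fun k => (hzmono (φ k)).monotone hii'
  have hζAB : ∀ i, ζ i ∈ Set.Icc A B := fun i => ⟨hζmem.1 i, hζmem.2 i⟩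
  -- the multiplicities: fibre cardinalities of `ζ`
  refine ⟨Finset.univ.image ζ, fun w => (Finset.univ.filter (fun i => ζ i = w)).card, ?_, ?_⟩
  swap
  · have h := Finset.card_eq_sum_card_image ζ (Finset.univ : Finset (Fin N))
    simp only [Finset.card_univ, Fintype.card_fin] at h
    exact h.le
  intro w hw
  obtain ⟨i, -, rfl⟩ := Finset.mem_image.mp hw
  refine ⟨hζAB i, ?_⟩
  intro j hj
  -- the fibre of `ζ i`: first index `i₀`, last index `i₁`
  set G : Finset (Fin N) := Finset.univ.filter (fun i' => ζ i' = ζ i) with hG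
  have hiG : i ∈ G := by simp [hG]
  have hGne : G.Nonempty := ⟨i, hiG⟩
  set i₀ := G.min' hGne with hi₀
  set i₁ := G.max' hGne with hi₁
  have hi₀G : i₀ ∈ G := Finset.min'_mem G hGne
  have hi₁G : i₁ ∈ G := Finset.max'_mem G hGne
  have hζ₀ : ζ i₀ = ζ i := (Finset.mem_filter.mp hi₀G).2
  have hζ₁ : ζ i₁ = ζ i := (Finset.mem_filter.mp hi₁G).2
  have hGsub : G ⊆ Finset.Icc i₀ i₁ := fun i' hi' =>
    Finset.mem_Icc.mpr ⟨Finset.min'_le G i' hi', Finset.le_max' G i' hi'⟩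
  have hcardI : j + 1 ≤ (Finset.Icc i₀ i₁).card := le_trans (Nat.succ_le_of_lt hj) (Finset.card_le_card hGsub)
  -- for every `k`: a zero `t k` of `fd (φ k) j` in the moving window `[z (φ k) i₀, z (φ k) i₁]`
  have hwin : ∀ k, ∃ t, t ∈ Set.Icc (z (φ k) i₀) (z (φ k) i₁) ∧ fd (φ k) j t = 0 := by
    intro k
    set W : Finset ℝ := (Finset.Icc i₀ i₁).image (z (φ k)) with hW
    have hWcard : W.card = (Finset.Icc i₀ i₁).card := Finset.card_image_of_injective _ (hzmono (φ k)).injective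
    have hWz : ∀ t ∈ W, t ∈ Set.Icc (z (φ k) i₀) (z (φ k) i₁) ∧ fd (φ k) 0 t = 0 := by
      intro t ht
      obtain ⟨i', hi', rfl⟩ := Finset.mem_image.mp ht
      rw [Finset.mem_Icc] at hi'
      exact ⟨⟨(hzmono (φ k)).monotone hi'.1, (hzmono (φ k)).monotone hi'.2⟩, (hz0 (φ k) i').2⟩
    obtain ⟨Z', hc', hZ'⟩ := rolle_count_iter (fd (φ k)) (hder (φ k)) _ _ j W hWz
    have hZ'ne : Z'.Nonempty := by
      rw [← Finset.card_pos]; omega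
    obtain ⟨t, ht⟩ := hZ'ne
    exact ⟨t, hZ' t ht⟩
  choose t htwin ht0 using hwin
  -- squeeze: `t k → ζ i`
  have htAB : ∀ k, t k ∈ Set.Icc A B := fun k =>
    ⟨le_trans (hz0 (φ k) i₀).1.1 (htwin k).1, le_trans (htwin k).2 (hz0 (φ k) i₁).1.2⟩
  have htlim : Tendsto t atTop (𝓝 (ζ i)) := by
    refine tendsto_of_tendsto_of_tendsto_of_le_of_le ?_ ?_ (fun k => (htwin k).1) (fun k => (htwin k).2)
    · rw [← hζ₀]; exact hlim_i i₀
    · rw [← hζ₁]; exact hlim_i i₁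
  -- continuous convergence
  have hjN : j < N := lt_of_lt_of_le hj (le_trans (Finset.card_le_univ _) (by simp))
  have h1 := hconv j hjN φ hφ t (ζ i) htAB htlim
  have h2 : Tendsto (fun k => fd (φ k) j (t k)) atTop (𝓝 0) := by
    simp only [ht0]; exact tendsto_const_nhds
  exact tendsto_nhds_unique h1 h2

end Summit.ValiantsHypothesis.ValiantsHypothesis.Theorems.LacunarySymmetroidMatrixDescartes.WallBubbling
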